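import Summits.ValiantsHypothesis.ValiantsHypothesis.Theorems.BarrierLeverChowBenchmarkPairsBlockPeelRows

/-!
# Route BarrierLever — item 22038 `ChowBenchmarkPairs`, line `moore-peel`: CERTIFICATE KIT for tied blocks — from ONE checked
# identity `A * B = 1` over `ZMod p` (with `A` the tabulated block matrix at a point) to the symbolic `det J^κ(i,t)(Λ) ≠ 0`

Helper file (`--supports stmt-ValiantsHypothesis-22038`; cell valiant-natproofs, rung V4, 𝒟-side benchmark of record, line
`moore_peel`; seat val-np-p4 gen 29; planner RULING R43 — the computational lane for node #1).  Closes NO item; KERNEL ONLY (no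
`native_decide` here).  One auxiliary definition (`tabulate`).  This is the pattern of `…BlockPeelCert363` made generic, so that a
future certificate for any block `(i, t)` is: a point `pt : Fin t → ZMod p`, an equivalence `e : BlockIdx i t ≃ Fin n`, inverse data
`B`, ONE `native_decide` proof of `tabulate n (reindex e e (blockMatrix κ i t pt)) * B = 1`, and then `det_blockMatrix_X_ne_zero_of_cert`.

* `tabulate n M` — `M : Matrix (Fin n) (Fin n) R` stored as an `Array` of rows and read back (so that a native evaluation computes each
  entry ONCE); `tabulate_eq : tabulate n M = M` is a kernel fact (`Array.getElem?_ofFn`), no evaluation.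
* `det_ne_zero_of_tabulate_mul_eq_one` — `tabulate n M * B = 1 ⇒ det M ≠ 0` (nontrivial commutative ring).
* **`det_blockMatrix_X_ne_zero_of_cert`** — for `κ`, `i`, `t`, a modulus `p > 1`, a point `pt`, `e : BlockIdx i t ≃ Fin n` and any `B`:
  `tabulate n (reindex e e (blockMatrix κ i t pt)) * B = 1 ⇒ det (blockMatrix κ i t X) ≠ 0` in `MvPolynomial (Fin t) ℤ` — the
  hypothesis shape of `kernelPoisedAt_of_blocks` / `Stmt.conjPrefixUpTo` (`…BlockPeel`, `…BlockPeelLadder`).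

WHAT THIS IS NOT: no certificate is checked here; nothing on crux stmt-ValiantsHypothesis-14610 or on `VP` versus `VNP`.
-/

set_option linter.dupNamespace false

namespace Summit.ValiantsHypothesis.ValiantsHypothesis.Theorems.BarrierLever.MoorePeel

open Polynomial Finset

/-- A square matrix on `Fin n` stored as an array of rows and read back (entrywise equal to `M`, `tabulate_eq`; under native
evaluation the closed term `Array.ofFn …` is computed once). -/
def tabulate {R : Type*} [Zero R] (n : ℕ) (M : Matrix (Fin n) (Fin n) R) : Matrix (Fin n) (Fin n) R := fun r c =>
  ((Array.ofFn fun r' : Fin n => Array.ofFn fun c' : Fin n => M r' c').getD r.val #[]).getD c.val 0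

/-- KERNEL FACT: the table is the matrix. -/
theorem tabulate_eq {R : Type*} [Zero R] (n : ℕ) (M : Matrix (Fin n) (Fin n) R) : tabulate n M = M := by
  funext r c
  simp only [tabulate, Array.getD_eq_getD_getElem?, Array.getElem?_ofFn, r.2, c.2, dif_pos, Option.getD_some]

/-- A right inverse of the table certifies `det M ≠ 0` (nontrivial commutative ring). -/
theorem det_ne_zero_of_tabulate_mul_eq_one {R : Type*} [CommRing R] [Nontrivial R] (n : ℕ) (M B : Matrix (Fin n) (Fin n) R)
    (h : tabulate n M * B = 1) : M.det ≠ 0 := by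
  rw [tabulate_eq] at h
  exact (Matrix.isUnit_det_of_right_inverse h).ne_zero

/-- **From a checked `A * B = 1` modulo `p` to the symbolic block determinant.**  For any weight `κ`, block `(i, t)`, modulus
`p > 1`, point `pt : Fin t → ZMod p`, window-order equivalence `e` and inverse candidate `B`:
`tabulate n (reindex e e (J^κ(i,t)(pt))) * B = 1 ⇒ det J^κ(i,t)(Λ) ≠ 0` in `ℤ[Λ_0, …, Λ_{t-1}]`. -/
theorem det_blockMatrix_X_ne_zero_of_cert (κ : ℕ → ℕ) (i t n p : ℕ) [Fact (1 < p)] (pt : Fin t → ZMod p)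
    (e : BlockIdx i t ≃ Fin n) (B : Matrix (Fin n) (Fin n) (ZMod p))
    (h : tabulate n (Matrix.reindex e e (blockMatrix κ i t pt)) * B = 1) :
    (blockMatrix κ i t (fun s : Fin t => (MvPolynomial.X s : MvPolynomial (Fin t) ℤ))).det ≠ 0 := by
  have hp : (blockMatrix κ i t pt).det ≠ 0 := by
    have := det_ne_zero_of_tabulate_mul_eq_one n _ B h
    rwa [Matrix.det_reindex_self] at this
  intro h0
  apply hp
  have e' := map_det_blockMatrix (MvPolynomial.eval₂Hom (Int.castRingHom (ZMod p)) pt) κ i t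
    (fun s : Fin t => (MvPolynomial.X s : MvPolynomial (Fin t) ℤ))
  rw [h0, map_zero] at e'
  simp only [MvPolynomial.coe_eval₂Hom, MvPolynomial.eval₂_X] at e'
  exact e'.symm

/-- The same with the point determinant as hypothesis (for certificates checked by other means). -/
theorem det_blockMatrix_X_ne_zero_of_point (κ : ℕ → ℕ) (i t : ℕ) {R : Type*} [CommRing R] (pt : Fin t → R)
    (hp : (blockMatrix κ i t pt).det ≠ 0) :
    (blockMatrix κ i t (fun s : Fin t => (MvPolynomial.X s : MvPolynomial (Fin t) ℤ))).det ≠ 0 := by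
  intro h0
  apply hp
  have e' := map_det_blockMatrix (MvPolynomial.eval₂Hom (Int.castRingHom R) pt) κ i t
    (fun s : Fin t => (MvPolynomial.X s : MvPolynomial (Fin t) ℤ))
  rw [h0, map_zero] at e'
  simp only [MvPolynomial.coe_eval₂Hom, MvPolynomial.eval₂_X] at e'
  exact e'.symm

end Summit.ValiantsHypothesis.ValiantsHypothesis.Theorems.BarrierLever.MoorePeel
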